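import Literature.AlgebraicGeometry.Modules.PullbackClosedImmersionUnitIso
import Literature.AlgebraicGeometry.Morphisms.IsoOverOpen
import HarnessLib

/-!
# The unit `M → f_* f^* M` over an open where `f` is an isomorphism

For a morphism of schemes `f : X → Y` which is an isomorphism over an open `D ⊆ Y` (i.e.
`f ∣_ D : f⁻¹D → D` is an isomorphism) and a quasi-coherent `𝒪_Y`-module `M`, **the adjunction map
`c : M → f_* f^* M` is an isomorphism over `D`**: on every affine open `D' ⊆ D` its sections
`Γ(D', M) → Γ(f⁻¹D', f^*M)` are bijective. This is the observation "since `f|_{f⁻¹(V)} : f⁻¹(V) → V`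
is an isomorphism we see that `c|_V` is an isomorphism" in the proof of The Stacks Project,
Tag 088B (push-pull of inverse systems), which we formalize through the affine chart computation
`Γ(U, f^*M) = Γ(U) ⊗_{Γ(V)} Γ(V, M)` (`Modules/PullbackAffineChart`) for the chart
`f♯ : Γ(D') ≅ Γ(f⁻¹D')`.

* `isAffineOpen_preimage_of_isIso_morphismRestrict`, `app_bijective_of_isIso_morphismRestrict`;
* **`unit_app_bijective_of_isIso_morphismRestrict`** — the theorem (and `unit_app_bijective_of_le`
  over every affine `D' ⊆ D`, using `Morphisms/IsoOverOpen.isIso_morphismRestrict_of_le`; the base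
  change `isIso_morphismRestrict_pullback_snd` of "isomorphism over `D`" is also there).

Everything is proved; no named facts.

## References

* The Stacks Project, Tag 088B (proof), Tag 01QY, Tag 02KG. [StacksProject]
* U. Görtz, T. Wedhorn, *Algebraic Geometry I*, 2nd ed. (2020), Prop. 7.24 (2). [GortzWedhorn2020]
-/

noncomputable section

-- `TopCat.Presheaf`/`Scheme.Modules` are not reducible (as in Mathlib's `AlgebraicGeometry/Modules`).
set_option backward.isDefEq.respectTransparency false

open CategoryTheory AlgebraicGeometry Limits TopologicalSpace Opposite TensorProduct
open scoped ChangeOfRings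

universe u

namespace Literature.AlgebraicGeometry.Morphisms

open Literature.AlgebraicGeometry.Modules Literature.AlgebraicGeometry.Motives

/-! ### Isomorphisms over an open -/

section Over

variable {X Y : Scheme.{u}} (f : X ⟶ Y) {D : Y.Opens}

/-- **`f⁻¹D'` is affine** for `D'` affine with `f ∣_ D'` an isomorphism. [folklore] -/
theorem isAffineOpen_preimage_of_isIso_morphismRestrict {D' : Y.Opens} [IsIso (f ∣_ D')]
    (hD' : IsAffineOpen D') : IsAffineOpen (f ⁻¹ᵁ D') :=
  haveI : IsAffine (D' : Scheme.{u}) := hD'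
  IsAffine.of_isIso (f ∣_ D')

/-- **`f♯ : Γ(D') → Γ(f⁻¹D')` is bijective** when `f ∣_ D'` is an isomorphism. [folklore] -/
theorem app_bijective_of_isIso_morphismRestrict (D' : Y.Opens) [IsIso (f ∣_ D')] :
    Function.Bijective (f.app D') := by
  have happ := morphismRestrict_appTop f D'
  -- `(f ∣_ D').appTop` is an isomorphism, and so is the `eqToHom` restriction
  haveI : IsIso ((f ∣_ D').appTop) := inferInstance
  haveI : IsIso (X.presheaf.map (eqToHom (image_morphismRestrict_preimage f D' ⊤)).op) :=
    inferInstance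
  have h2 : IsIso (f.app (D'.ι ''ᵁ ⊤)) := by
    have h3 : f.app (D'.ι ''ᵁ ⊤) = (f ∣_ D').appTop ≫
        inv (X.presheaf.map (eqToHom (image_morphismRestrict_preimage f D' ⊤)).op) := by
      rw [happ, Category.assoc, IsIso.hom_inv_id, Category.comp_id]
    rw [h3]; infer_instance
  have e : D'.ι ''ᵁ ⊤ = D' := D'.ι_image_top
  have h4 : IsIso (f.app D') := by rw [← e]; exact h2
  exact ConcreteCategory.bijective_of_isIso (f.app D')

end Over

/-! ### The unit over an open where `f` is an isomorphism -/

section Unit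

variable {X Y : Scheme.{u}} (f : X ⟶ Y) (M : Y.Modules)

/-- **`Γ(D', M) → Γ(f⁻¹D', f^*M)` is bijective for `D'` affine with `f ∣_ D'` an isomorphism** and
`M` affine-localizing: the sections of the unit `M → f_* f^* M` over `D'`.
[cite: StacksProject, Tag 088B (proof: "`c|_V` is an isomorphism")] -/
theorem unit_app_bijective_of_isIso_morphismRestrict (hM : IsAffineLocalizing M) {D' : Y.Opens}
    (hD' : IsAffineOpen D') [IsIso (f ∣_ D')] :
    Function.Bijective (((Scheme.Modules.pullbackPushforwardAdjunction f).unit.app M).app D') := by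
  have hU : IsAffineOpen (f ⁻¹ᵁ D') := isAffineOpen_preimage_of_isIso_morphismRestrict f hD'
  have heq : (fun m => ((Scheme.Modules.pullbackPushforwardAdjunction f).unit.app M).app D' m) =
      unitSectionLE f M (le_refl (f ⁻¹ᵁ D')) := by
    funext m
    change unitSection f M D' m = ((Scheme.Modules.pullback f).obj M).presheaf.map (homOfLE _).op _
    rw [presheaf_map_congr _ (homOfLE (le_refl (f ⁻¹ᵁ D'))) (𝟙 _), op_id,
      CategoryTheory.Functor.map_id]
    rfl
  change Function.Bijective
    (fun m => ((Scheme.Modules.pullbackPushforwardAdjunction f).unit.app M).app D' m)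
  rw [heq]
  refine unitSectionLE_bijective_of f M hD' (le_refl _) hU hM ?_
  have hψ : chartHom f (le_refl (f ⁻¹ᵁ D')) = f.app D' := (Scheme.Hom.app_eq_appLE f).symm
  have hbij := app_bijective_of_isIso_morphismRestrict f D'
  refine one_tmul_bijective_of_surjective (chartHom f (le_refl (f ⁻¹ᵁ D'))).hom (restrictTop M hD')
    (by rw [hψ]; exact hbij.2) fun b hb p => ?_
  rw [hψ] at hb
  rw [hbij.1 (hb.trans (map_zero (f.app D').hom).symm), zero_smul]

/-- The same over any affine `D' ⊆ D` when `f` is an isomorphism over `D`. [cite: StacksProject, Tag 088B] -/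
theorem unit_app_bijective_of_le (hM : IsAffineLocalizing M) {D : Y.Opens} [IsIso (f ∣_ D)]
    {D' : Y.Opens} (hD' : IsAffineOpen D') (h : D' ≤ D) :
    Function.Bijective (((Scheme.Modules.pullbackPushforwardAdjunction f).unit.app M).app D') :=
  haveI := isIso_morphismRestrict_of_le f h
  unit_app_bijective_of_isIso_morphismRestrict f M hM hD'

end Unit

end Literature.AlgebraicGeometry.Morphisms

end
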